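import Summits.QuantumFields.YangMills.Theorems.BalabanUVNodesN16Thm4TorusEntryOfN05UniformP
import Literature.MathematicalPhysics.QuantumFieldTheory.Balaban1983to89.Node00.Record12NumericsFamilyDict
import Literature.MathematicalPhysics.QuantumFieldTheory.Balaban1983to89.B10Eq29TubeLine

/-!
# Route «BalabanUVNodes», crux K3⁸ `SpineGivenEndpointR13SepCoPHV` (stmt-QuantumFields-27366), node N16 = NE3 — THE TOP KNIT, PART (D): THE MATRIX-VALUED STAGE-3 DICTIONARY OF
# THE FAMILY `stage3OfFamilyMat F N` (node00's `stage3OfFamily F` with the coefficient C⋆-algebra `𝔸 := M_N(ℂ)` in place of `ℂ`) AND THE BRIDGE «node N05's Σ-object at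
# `stage3OfFamilyMat F N` ⟹ node N16's chain-entry object `hE` (θ-free, at `M_N(ℂ)`)» — p683332 ∘ instance identification

Cell `pub-ymgap`, seat `pub-ymgap-dag-n16-e` (R134 acceleration seat (a), strategy s2 = BY-NAME KNIT at the record; HUMAN RULING D-0062; chair R424 venue), generation 24,
module 58 (DEFINITION lane: ONE `def` — a parameter dictionary, no content — + `rfl` faces + two bridge theorems; 0 `sorry`, standard axioms; Theses-free, importable).
`--kind definition --supports stmt-QuantumFields-27366 --as helper` (count-neutral; proves NO registered stub).  `bears_on: R4∕N16 · edge N05 → N16`.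

WHY (HOME `HANDOFF.md` §g23 (a), `LOCATED-N16-N05-RECORD-CURRENCY.md`, g10 datum (D2)).  Node N05's theorems — in particular dag-n05-d's Σ-edition p681888
`…N05SubBP2DK2PerKappaThm4Prop3BodiesUniformPOfBindersLettersPerDoorL.exists_thm4Body_prop3Body_uniformP_of_bindersLettersPer_doorL` — and generation 23's N16-side readers of it
(p676051 … p683332) are stated over a BUNDLED Stage-3 parameter record `θ : Node00.Stage3Params` (coefficient C⋆-algebra `θ.𝔸`, dimension `θ.D`, block size `θ.L`; the κ-cut
`IdxB8SubDPerκ θ P Mκ Rκ` is θ-indexed), while node N16's objects of record (`NE3Carriers N`, `PrintSlotHolder`, `N16HolderAt`, dag-n16-c's chain entry `n16_holder_of_thm4TorusAt_print`)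
are `M_N(ℂ)`-valued over `Site 4` with block size `F.L`.  The record's Stage-3 dictionary of the family, node00's `stage3OfFamily F` (`Node00/Record12NumericsFamilyDict`), has
`𝔸 := ℂ` (a bookkeeping witness); N16 therefore reads its in-edge at THE SAME dictionary with the coefficient algebra replaced by `Matrix (Fin N) (Fin N) ℂ` carrying the
`L²`-operator-norm C⋆-structure (`B10Eq29TubeLine.cstarAlgebraMatrix N` = the `letI … := {}` structure every matrix module of the cell assembles locally): `stage3OfFamilyMat F N`
(§1; `D = 4`, `L = F.L`, `𝔸 = M_N(ℂ)`, `toStage1Params = (stage3OfFamily F).toStage1Params`, all `rfl`).  §2 is the BRIDGE of the top knit: node N05's Σ-object at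
`θ := stage3OfFamilyMat F N` with periods `Nper·F.Lᵏ` (p681888's conclusion text at `ι := {k ∕∕ 1 ≤ k}`, pin equations dropped — generation 23's displayed `hN05` VERBATIM)
⟹ node N16's θ-free chain-entry object `hE` of module 57 (`…N16OfEntryAtRecord13CoPH`): `∃ B Bh c₁′, 0 < B ∧ 0 < c₁′ ∧ 16·(B·c₁′) ≤ 1 ∧ ∀ k ≥ 1, Thm4TorusAt F.L k (Nper·F.Lᵏ) (F.Lᵏ)⁻¹ c₁′
(unitaryUnits (M_N ℂ)) ⊤ (Restr129 F.L k (torusLam k)) Concl_print(B, B_h; β)` — p682027's `exists_window_thm4TorusAt_entry_forall_depth_of_uniform_bodies` at `Reg := ⊤` with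
`B := 5·4·F.L·inp.B₀ > 0`, `B_h := 5·4·F.L·B₀β`, `16·B·c₁′ ≤ 1` from the window; the instance path `θ.𝔸 ↦ M_N(ℂ)` (norm, `Ad = conjR`, `unitaryUnits`) is definitional.  With module
57 §4 this closes the `h5 ↦ hN05` editions of module 37ᴴ by ONE application per family (module 59).

WHAT IS PROVED ([folklore] bookkeeping; no estimate).  §1 `stage3OfFamilyMat` (def) · `stage3OfFamilyMat_𝔸 ∕ _D ∕ _L ∕ _toStage1Params ∕ _ℓ₆_succ` (`rfl` ∕ node00's) ·
`admissible_stage3OfFamilyMat` · `two_le_D_stage3OfFamilyMat`.  §2 ★★★ `exists_entry_of_n05UniformP` (any `Nper ≥ 1`; at RR-1's period `ne3NperOfRecord₁₁ F 0 0` it is module 57's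
`hE F` to the letter — the composition with module 57 §4 is module 59).  §3 (v1.1, appended) `finiteDimensional_complex_stage3OfFamilyMat` ·
`finiteDimensional_real_stage3OfFamilyMat` (the `[FiniteDimensional ℝ θ.𝔸]` argument of p681888 at the dictionary, BY NAME — instance search does not unfold the head symbol).  §4 (v1.2,
appended after FLAG №14 T1 p694656) `stage3OfFamilyMat_two_eq_stage3OfFamily : stage3OfFamilyMat F 2 = stage3OfFamily F` (`rfl` — the record is now `M₂(ℂ)`-valued).

HONEST FRAMING.  A parameter dictionary and by-name bookkeeping; nothing of Bałaban's is proved here.  `hN05` (node N05's Σ-object: [Balaban1985RegularSpaces] Thm 4 ∕ Prop 3 BODIES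
with ONE threshold pair at every print-class periodic member of every period `Nper·F.Lᵏ`) is a DISPLAYED HYPOTHESIS — node N05's p681888 inhabits it at `stage3OfFamilyMat F N`
GIVEN node N06's five per-period analytic binders and [4]'s periodic letter families THERE (N06 content, not discharged; the tree's N06 object layer of record is at
`stage3OfFamily F`, `𝔸 = ℂ`); no admissible Stage-13 tuple is claimed to exist (K0 OPEN); no stub of K3⁸ v7 closed or claimed; **N16 ∕ N05 ∕ N06 NOT discharged**; counts
UNMOVED (typed 28∕28 · discharged 7∕27 · A 7∕28 — the chair's line is the only count).  One finite four-torus at fixed `ε`, Bałaban AS PRINTED — NOT ℝ⁴, NOT infinite volume,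
NOT OS, NOT a mass gap; the Yang–Mills mass gap (Clay) is NOT proved by any of this — R4 closes the conditional finite-𝕋⁴ rung `BalabanLadder.UV` only.
References: [Balaban1985RegularSpaces] T. Bałaban, CMP **99** (1985) 75–102, Thm 4 p. 88 («There exists a constant c₁»), Prop. 3 p. 87, (1.36)–(1.39) pp. 82–83, p. 77;
[Balaban1984PropagatorsII] T. Bałaban, CMP **96** (1984) 223–250, (2.1)–(2.4) p. 224 (the Stage-3 parameters).
-/

set_option autoImplicit false

open scoped BigOperators Matrix Matrix.Norms.L2Operator
open NormedSpace

namespace Summit.QuantumFields.YangMills.BalabanUVNodes.N16Stage3OfFamilyMat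

open Literature.MathematicalPhysics.QuantumFieldTheory.Balaban1983to89
open Literature.MathematicalPhysics.QuantumFieldTheory.Balaban1983to89.T4Continuum (T4Family)
open B7Prop1Explicit B7Prop2Explicit
open T4AveragingDeficitWall (Ad)
open B7Eq92Concrete (mgauge)
open B8Ineq132 (covDerivFwd)
open B8Eq184Proof (cfgExp)
open B8Eq119TwistedAxial (Restr129)
open B8Eq138LandauZd (IsLandau138 covLap)
open B8Thm4TorusAt (torusLam Thm4TorusAt)
open B8LeafModelZdHP2Per (zdGF3HP₂Per)
open Node00 (Stage3Params IdxB8SubDPerκ stage3OfFamily stage3OfFamily_ℓ₆_succ admissible_stage3OfFamily)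
open N16.Thm4TorusOfHP2PerUniform (exists_window_thm4TorusAt_entry_forall_depth_of_uniform_bodies)
-- `Site` alone could resolve to the torus sites; re-export the `ℤ^d` sites of `B7Prop1Explicit`.
export B7Prop1Explicit (Site)

noncomputable section

/-! ## §1 The matrix-valued Stage-3 dictionary of the family -/

/-- **THE MATRIX-VALUED STAGE-1∕2∕3 DICTIONARY OF THE FAMILY `F` AT COLOUR NUMBER `N`** — node00's dictionary of the family `stage3OfFamily F` (two colours, rotation flow, `D = 4`,
unit windows, block size `L := F.L`, `d₆ = 3`, `ℓ₆ = F.L − 1`, weight band `1`, Lemma-2.1 rate `2∕L`) with the coefficient C⋆-algebra `𝔸 := M_N(ℂ)` (print's `M_N(ℂ)`; the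
`L²`-operator-norm C⋆-structure `B10Eq29TubeLine.cstarAlgebraMatrix N`, nontrivial for `N ≥ 1`) in place of the bookkeeping witness `ℂ`.  The Stage-3 record at which node N16
(objects `M_N(ℂ)`-valued over `Site 4`, block size `F.L`) reads node N05's θ-bundled theorems.
[cite: Balaban1984PropagatorsII, (2.1)–(2.4) p.224; Balaban1985RegularSpaces, p.76 («gauge field configurations with values in G ⊂ M_N(ℂ)») (parameter dictionary; bookkeeping witness)] -/
def stage3OfFamilyMat (F : T4Family) (N : ℕ) [NeZero N] : Stage3Params :=
  haveI : Nonempty (Fin N) := ⟨⟨0, Nat.pos_of_ne_zero (NeZero.ne N)⟩⟩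
  { stage3OfFamily F with
    𝔸 := Matrix (Fin N) (Fin N) ℂ
    instCStar := B10Eq29TubeLine.cstarAlgebraMatrix N
    instNontrivial := inferInstance }

variable (F : T4Family) (N : ℕ) [NeZero N]

/-- The coefficient algebra is `M_N(ℂ)` (`rfl`). [folklore] -/
theorem stage3OfFamilyMat_𝔸 : (stage3OfFamilyMat F N).𝔸 = Matrix (Fin N) (Fin N) ℂ := rfl

/-- The physical dimension is `4` (`rfl`). [folklore] -/
theorem stage3OfFamilyMat_D : (stage3OfFamilyMat F N).D = 4 := rfl

/-- The block size is the family's `F.L` (`rfl`). [folklore] -/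
theorem stage3OfFamilyMat_L : (stage3OfFamilyMat F N).L = F.L := rfl

/-- The Stage-1 part IS node00's dictionary of the family (`rfl`): every Stage-1-keyed record theorem at `stage3OfFamily F` applies verbatim. [folklore] -/
theorem stage3OfFamilyMat_toStage1Params : (stage3OfFamilyMat F N).toStage1Params = (stage3OfFamily F).toStage1Params := rfl

/-- `ℓ₆ + 1 = F.L` (node00's `stage3OfFamily_ℓ₆_succ`). [folklore] -/
theorem stage3OfFamilyMat_ℓ₆_succ : (stage3OfFamilyMat F N).ℓ₆ + 1 = F.L := stage3OfFamily_ℓ₆_succ F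

/-- The dictionary is Stage-1 admissible (node00's `admissible_stage3OfFamily`; `Stage1Params.Admissible` reads no coefficient-algebra letter). [folklore] -/
theorem admissible_stage3OfFamilyMat : (stage3OfFamilyMat F N).toStage1Params.Admissible := admissible_stage3OfFamily F

/-- `2 ≤ D` (`D = 4`) — the side condition of generation 23's readers. [folklore] -/
theorem two_le_D_stage3OfFamilyMat : 2 ≤ (stage3OfFamilyMat F N).D := by
  rw [stage3OfFamilyMat_D]; norm_num

/-! ## §2 The bridge: node N05's Σ-object at `stage3OfFamilyMat F N` ⟹ node N16's θ-free chain-entry object `hE` -/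

/-- **★★★ THE BRIDGE OF THE TOP KNIT — NODE N05's Σ-OBJECT AT THE MATRIX-VALUED DICTIONARY OF THE FAMILY ⟹ NODE N16's CHAIN-ENTRY OBJECT** (family `F`, colour number `N ≥ 1`,
torus count `Nper ≥ 1`, pins `(Mκ, Rκ)`, Hölder pair `(β, len)` with `0 ≤ β`, `len ≥ 1` on its support, `len (e μ) = 1`).  `hN05` = the conclusion text of node N05's p681888 at
`θ := stage3OfFamilyMat F N`, period family `ν ↦ Nper·F.L^ν` (`ν : {k ∕∕ 1 ≤ k}`), pin equations dropped (= generation 23's p683332 `hN05`).  THEN module 57's `hE`: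
`∃ B Bh c₁′, 0 < B ∧ 0 < c₁′ ∧ 16·(B·c₁′) ≤ 1 ∧ ∀ k ≥ 1, Thm4TorusAt F.L k (Nper·F.Lᵏ) (F.Lᵏ)⁻¹ c₁′ (unitaryUnits (M_N ℂ)) ⊤ (Restr129 F.L k (torusLam k)) Concl_print(B, B_h; β)`
(`B = 5·4·F.L·inp.B₀`, `B_h = 5·4·F.L·B₀β`).  p682027's `exists_window_thm4TorusAt_entry_forall_depth_of_uniform_bodies` at `θ := stage3OfFamilyMat F N`, `Reg := ⊤`; `16·B·c₁′ ≤ 1`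
from the window at `α₀ = α₁ = c₁′∕2`; the coefficient-algebra instance path (`‖·‖`, `unitaryUnits`, `Ad = conjR`) is definitional.
[cite: Balaban1985RegularSpaces, Thm 4 p.88 («There exists a constant c₁»), Prop. 3 p.87, (1.36)–(1.39) pp.82–83, p.77] [folklore] -/
theorem exists_entry_of_n05UniformP {Nper : ℕ} (hN : 1 ≤ Nper) (Mκ Rκ : ℕ)
    {β : ℝ} (hβ : 0 ≤ β) {len : Site 4 → ℝ} (hlen : ∀ v : Site 4, 0 < len v → 1 ≤ len v) (hlen1 : ∀ μ : Fin 4, len (e μ) = 1)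
    (hN05 : letI : CStarAlgebra (Matrix (Fin N) (Fin N) ℂ) := B10Eq29TubeLine.cstarAlgebraMatrix N
      ∃ (inp : B8.B9Inputs) (B₀β B₈ c₄ c₃ : ℝ), inp.B₀ ≤ B₈ ∧ 0 < c₄ ∧ 0 < c₃ ∧
      ∀ (ν : {k : ℕ // 1 ≤ k}) (a : IdxB8SubDPerκ (stage3OfFamilyMat F N) (Nper * F.L ^ ν.1) Mκ Rκ),
        B8.Thm4Body c₄ (5 * ((4 : ℕ) : ℝ) * F.L * B₈) (fun _ : Unit => (zdGF3HP₂Per (Matrix (Fin N) (Fin N) ℂ) F.L β len a.toZdIdx (Nper * F.L ^ ν.1)).toGFData) ∧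
        B8.Prop3Body c₃ 4 (F.L : ℝ) (2097152 * (((4 : ℕ) : ℝ) + 1) ^ 2 * (F.L : ℝ) ^ 2) inp B₀β
          (fun _ : Unit => (zdGF3HP₂Per (Matrix (Fin N) (Fin N) ℂ) F.L β len a.toZdIdx (Nper * F.L ^ ν.1)).toGFData2)) :
    ∃ B Bh c₁' : ℝ, 0 < B ∧ 0 < c₁' ∧ 16 * (B * c₁') ≤ 1 ∧
      ∀ k, 1 ≤ k → Thm4TorusAt F.L k (((Nper * F.L ^ k : ℕ) : ℤ)) (((F.L : ℝ) ^ k)⁻¹) c₁' (unitaryUnits (Matrix (Fin N) (Fin N) ℂ))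
        (fun _ => True) (Restr129 F.L k (torusLam k))
        (fun (α₀ α₁ : ℝ) (U₀ U' : Site 4 → Fin 4 → (Matrix (Fin N) (Fin N) ℂ)ˣ) (u : Site 4 → (Matrix (Fin N) (Fin N) ℂ)ˣ) =>
          ∃ A : Site 4 → Fin 4 → Matrix (Fin N) (Fin N) ℂ,
            (∀ x μ, IsSelfAdjoint (A x μ)) ∧ (∀ (x : Site 4) (κ μ : Fin 4), A (x + (((Nper * F.L ^ k : ℕ) : ℤ)) • e κ) μ = A x μ) ∧
            mgauge U₀ u (cfgExp (((F.L : ℝ) ^ k)⁻¹) A) = U' ∧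
            (∀ x μ, ‖A x μ‖ ≤ B * (α₀ + α₁)) ∧
            (∀ (μ : Fin 4) (x : Site 4) (κ : Fin 4), ‖covDerivFwd (((F.L : ℝ) ^ k)⁻¹) U₀ μ (fun z => A z κ) x‖ ≤ B * (α₀ + α₁)) ∧
            IsLandau138 F.L k (((F.L : ℝ) ^ k)⁻¹) Set.univ (torusLam k) U₀ A ∧
            (∀ (μ : Fin 4) (y : Site 4) (κ : Fin 4),
              ‖Ad (U₀ y μ) (covDerivFwd (((F.L : ℝ) ^ k)⁻¹) U₀ μ (fun z => A z κ) (y + e μ)) - covDerivFwd (((F.L : ℝ) ^ k)⁻¹) U₀ μ (fun z => A z κ) y‖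
                ≤ Bh * (α₀ + α₁) * (((F.L : ℝ)⁻¹) ^ k) ^ β) ∧
            (∀ (x : Site 4) (κ : Fin 4), ‖covLap (((F.L : ℝ) ^ k)⁻¹) U₀ (fun z => A z κ) x‖ ≤ B * (α₀ + α₁))) := by
  obtain ⟨inp, B₀β, B₈, c₄, c₃, hB08, hc₄, hc₃, H⟩ := hN05
  have hL : 2 ≤ F.L := F.hL.2
  have h5 : 0 < 5 * ((4 : ℕ) : ℝ) * F.L := by
    have hL0 : (0 : ℝ) < F.L := by exact_mod_cast lt_of_lt_of_le (by norm_num) hL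
    positivity
  have hB₈ : 0 < B₈ := lt_of_lt_of_le inp.B₀_pos hB08
  have hB₁' : 0 < 5 * ((4 : ℕ) : ℝ) * F.L * B₈ := mul_pos h5 hB₈
  have hBB : 5 * ((4 : ℕ) : ℝ) * F.L * inp.B₀ ≤ 5 * ((4 : ℕ) : ℝ) * F.L * B₈ := mul_le_mul_of_nonneg_left hB08 h5.le
  have hB0 : 0 < 5 * ((4 : ℕ) : ℝ) * F.L * inp.B₀ := mul_pos h5 inp.B₀_pos
  obtain ⟨c₁', hc₁', hwin, hT⟩ := exists_window_thm4TorusAt_entry_forall_depth_of_uniform_bodies (θ := stage3OfFamilyMat F N)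
    (two_le_D_stage3OfFamilyMat F N) hN Mκ Rκ hβ hlen hlen1 hc₄ hc₃ hB₁' hBB (fun k hk a => H ⟨k, hk⟩ a) (fun _ _ => True)
  refine ⟨5 * ((4 : ℕ) : ℝ) * F.L * inp.B₀, 5 * ((4 : ℕ) : ℝ) * F.L * B₀β, c₁', hB0, hc₁', ?_, hT⟩
  -- `16·B·c₁′ ≤ 1` from the window at `α₀ = α₁ = c₁′/2` and `B ≤ B₁′`
  have hh : 0 < c₁' / 2 := by linarith
  obtain ⟨-, -, -, h16, -⟩ := hwin (c₁' / 2) (c₁' / 2) hh hh (by linarith)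
  have hs : c₁' / 2 + c₁' / 2 = c₁' := by ring
  rw [hs] at h16
  nlinarith [mul_le_mul_of_nonneg_right hBB hc₁'.le]

/-! ## §3 (v1.1) The coefficient algebra of the dictionary is finite-dimensional — the instance argument of node N05's p681888, BY NAME -/

/-- **`(stage3OfFamilyMat F N).𝔸` IS FINITE-DIMENSIONAL OVER `ℂ`** — `M_N(ℂ)` is; stated BY NAME because instance search does not unfold the dictionary's head symbol
(`infer_instance` on `FiniteDimensional ℂ (stage3OfFamilyMat F N).𝔸` fails, the explicit term elaborates definitionally). [folklore] -/
theorem finiteDimensional_complex_stage3OfFamilyMat : FiniteDimensional ℂ (stage3OfFamilyMat F N).𝔸 :=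
  (inferInstance : FiniteDimensional ℂ (Matrix (Fin N) (Fin N) ℂ))

/-- **`(stage3OfFamilyMat F N).𝔸` IS FINITE-DIMENSIONAL OVER `ℝ`** for the real structure restricted from `ℂ` (`Module.complexToReal`, the structure under which node N05's
`…exists_thm4Body_prop3Body_uniformP_of_bindersLettersPer_doorL` asks `[FiniteDimensional ℝ θ.𝔸]`): Mathlib's `FiniteDimensional.complexToReal` at `M_N(ℂ)`.  A consumer
instantiating p681888 at `θ := stage3OfFamilyMat F N` supplies this term for that instance argument (`haveI := finiteDimensional_real_stage3OfFamilyMat F N`). [folklore] -/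
theorem finiteDimensional_real_stage3OfFamilyMat : FiniteDimensional ℝ (stage3OfFamilyMat F N).𝔸 :=
  FiniteDimensional.complexToReal (Matrix (Fin N) (Fin N) ℂ)

/-! ## §4 (v1.2) After node00's RECORD-NONABELIAN RE-KEY (FLAG №14 T1, p694656): at `N = 2` the dictionary IS node00's dictionary of the family -/

/-- **`stage3OfFamilyMat F 2 = stage3OfFamily F` (`rfl`)** — since node00-def-RR-2's T1 edition of `Node00/Record12Numerics` (p694656: `N₅ := 2`, `𝔸 := Matrix (Fin 2) (Fin 2) ℂ`,
`instCStar := B10Eq29TubeLine.cstarAlgebraMatrix 2`, `instNontrivial := inferInstance`; FLAG №14 «RECORD-ABELIAN» cure road, director-ym №256∕№259) the record's own dictionary of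
the family carries `M₂(ℂ)`, and this seat's matrix-valued dictionary at colour number `2` coincides with it DEFINITIONALLY (same structure update field by field; the `Nontrivial`
fields are proofs of a `Prop`).  Hence every module-59∕59g statement at `stage3OfFamilyMat F 2` is, by definitional transport, a statement at `stage3OfFamily F` — the θ at which the
K1⁹ face of record displays node N05 ∕ N06 (module 59h). [folklore] -/
theorem stage3OfFamilyMat_two_eq_stage3OfFamily : stage3OfFamilyMat F 2 = stage3OfFamily F := rfl

end

end Summit.QuantumFields.YangMills.BalabanUVNodes.N16Stage3OfFamilyMat
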